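import Summits.ResolutionOfSingularities.ResolutionOfSingularities.Theorems.DeltaCutStellarLow
import Summits.ResolutionOfSingularities.ResolutionOfSingularities.Theorems.DeltaCutStellarExact

/-!
# StellarCut N23c — «NonResonant»: the NON-RESONANT LABELLED class `ncHypShapeNR n` — p-FREE, characteristic-free — star-stable at
# EVERY marking, and its list law (lens-6 «barrier-complement carving», g37 door 4; family (iii-b) of the critic's WINDOW g37/g38)

Route `MaxContactCut`, column `E1TopNoAbs`; decomposition lineage `decomp-res-lens-6`.

THE CLASS.  `ncHypShapeNR n X E H M`: the unit-free hypersurface shape at marking `n ≠ 0` (T17a) whose exponents satisfy, along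
their divisors, `a = 0 ∨ a % n ≠ 0` — NO positive label is a multiple of the marking.  The condition names NO prime and NO unit:
it contains T18's coprime class at `n = p` (`ncHypShapeCop.toNR`) and R22a's low-residue class at every `p ∣ n`
(`ncHypShapeLow.toNR`), and — its content — the labels of residue `≥ p` (g34's witness `(z : 3, w : 3)` at `n = 4` in
characteristic `2`, N23e), where EVERY tight face is `p`-divisible and the first-order guards of T15/T17b are dead.

THE MECHANISM (new at g37).  Every face of a non-resonant datum is EXACT (`ncHypShapeNR.exactFace`; N23b `ExactFace`): the round
lemma is N23b's `ncHypShapeF.transform_of_exact` — the near-point bound with the exact exponent `e := n` and the HIGHER-ORDER HASSE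
GUARD of N23a (an operator `D^{(β)}` of order `|β| < n` with `D^{(β)} G` a unit·monomial, in every characteristic).  The label
bookkeeping along Kollár's star phases is `nr_weightOf_sub_of_starBelowH`: phase `r = 2` gives the new label `a_K − n ≡ a_K (mod n)`,
phase `r ≥ 3` gives a new label `< n` (the star bounds), whose residue is itself — non-resonance is FREE there.

* §NRShape — `ncHypShapeNR`, API, `exactFace`, the inclusions `ncHypShapeLow.toNR`, `ncHypShapeCop.toNR`;
* §Labels — `nr_weightOf_sub_of_starBelowH`;
* §Round — `ncHypShapeNR.transform_star`, `faceStableShapeStar_ncHypShapeNR`, ★★ `ncHypShapeNR.exists_weakResolution` (T16 BY NAME).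

NOT in the class (and not claimed): a positive label that IS a multiple of `n` (`h⁴ + u·z⁴` in characteristic `2`, the
composite-marking kangaroo: order `4` at `h = z` on the `z`-chart — the exact guard GENUINELY fails there), see N23d's `Rest6`.

0 sorry; axioms standard. [new] [cite: Kollar2007, (3.111) Step 3] [cite: CossartPiltant2008, Prop. 4.2 (a)] [cite: EGAIV4, Thm. 16.11.2]
-/

noncomputable section

open CategoryTheory CategoryTheory.Limits AlgebraicGeometry TopologicalSpace IsLocalRing
open Literature.AlgebraicGeometry.Resolution

namespace Summit.ResolutionOfSingularities.ResolutionOfSingularities.Theorems.DeltaCutClasses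

open Summit.ResolutionOfSingularities.ResolutionOfSingularities.Theorems
open WeakOrderReduction ForcedTowerClasses

/-! ### §NRShape — the non-resonant labelled shape -/

section NRShape

variable {X : Scheme.{0}} {E : List (X.IdealSheafData × ℕ)} {H : X.IdealSheafData} {p n : ℕ} {M : MarkedIdeal X}

/-- **THE NON-RESONANT SHAPE `ncHypShapeNR n`** (a `Shape`): the unit-free hypersurface shape at marking `n ≠ 0` (T17a), and the
exponent `a` of every boundary member `K` satisfies, along `V(K)`, `a = 0 ∨ a % n ≠ 0` — no positive label is a multiple of the
marking.  NO prime, NO unit, NO characteristic.  DEFINITION (letter · intrinsic: T17a's shape and the exponents of `E` only). [new] -/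
def ncHypShapeNR (n : ℕ) : Shape := fun X E H M =>
  ncHypShapeF n X E H M ∧ n ≠ 0 ∧ ∀ (K : X.IdealSheafData) (y : X), y ∈ K.support → expOf E K = 0 ∨ expOf E K % n ≠ 0

namespace ncHypShapeNR

/-- the underlying unit-free shape -/
theorem toF (hP : ncHypShapeNR n X E H M) : ncHypShapeF n X E H M := hP.1

/-- the marking is nonzero -/
theorem ne_zero (hP : ncHypShapeNR n X E H M) : n ≠ 0 := hP.2.1

/-- the exponents are non-resonant along their divisors -/
theorem labels (hP : ncHypShapeNR n X E H M) {K : X.IdealSheafData} {y : X} (hy : y ∈ K.support) :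
    expOf E K = 0 ∨ expOf E K % n ≠ 0 := hP.2.2 K y hy

/-- ★ **EVERY FACE OF A NON-RESONANT DATUM IS EXACT** (N23b `ExactFace`, second disjunct). [new] -/
theorem exactFace (hP : ncHypShapeNR n X E H M) (T : Finset X.IdealSheafData) : ExactFace n X E T :=
  Or.inr fun _ _ _ hy => hP.labels hy

end ncHypShapeNR

/-- **R22a's low-residue class (any `p ∣ n`) is non-resonant** (`0 < a % n ⇒ a % n ≠ 0`). [new] -/
theorem ncHypShapeLow.toNR (hP : ncHypShapeLow p n X E H M) : ncHypShapeNR n X E H M :=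
  ⟨hP.toF, by have h := hP.two_le; omega, fun _ _ hy => (hP.labels hy).imp_right fun h => Nat.pos_iff_ne_zero.mp h.1⟩

/-- **T18's coprime class (marking `p`) is non-resonant** (`p ∤ a ⇒ a % p ≠ 0`). [new] -/
theorem ncHypShapeCop.toNR (hP : ncHypShapeCop p X E H M) : ncHypShapeNR p X E H M :=
  ⟨hP.toF, hP.prime.ne_zero, fun _ _ hy => (hP.labels hy).imp_right fun h hmod => h (Nat.dvd_of_mod_eq_zero hmod)⟩

/-- conversely, at a PRIME marking `p` with `p = 0` in the stalks, a non-resonant datum is a coprime datum (T18). [new] -/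
theorem ncHypShapeNR.toCop (hp : p.Prime) (hcast : ∀ x : X, ((p : ℕ) : X.presheaf.stalk x) = 0) (hP : ncHypShapeNR p X E H M) :
    ncHypShapeCop p X E H M :=
  ⟨hP.toF, hp, hcast, fun _ _ hy => (hP.labels hy).imp_right fun h hdvd => h (Nat.mod_eq_zero_of_dvd hdvd)⟩

end NRShape

/-! ### §Labels — the new label along the star phases is non-resonant, at EVERY marking -/

section Labels

variable {X : Scheme.{0}} {E : List (X.IdealSheafData × ℕ)} {H : X.IdealSheafData} {T : Finset X.IdealSheafData} {n : ℕ}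

/-- ★ **THE NEW LABEL IS NON-RESONANT ALONG THE STAR PHASES, AT EVERY MARKING.**  For an `r`-set `T ∋ H` of boundary members with
the `H`-exponent `0`, non-resonant labels on `T`, and the star bounds `(*ₛ)^H` (`s < r`): the new label `weightOf E T − n` is `0` or
NOT a multiple of `n` — phase `r = 2`: it is `a_K − n ≡ a_K (mod n)`; phase `r ≥ 3`: `a_K ≤ weightOf E {H, K} < n` and
`weightOf E T = a_K + weightOf E (T ∖ K) < a_K + n`, so `weightOf E T − n < a_K < n` IS its own residue (non-resonance is free in
phase `≥ 3`). [new] [cite: Kollar2007, (3.111) Step 3] -/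
theorem nr_weightOf_sub_of_starBelowH {r : ℕ} (hTrH : T ∈ incSubsetsH E H r) (hstar : StarBelowH E H n r)
    (hH0 : expOf E H = 0) (hnr : ∀ K ∈ T, expOf E K = 0 ∨ expOf E K % n ≠ 0) :
    weightOf E T - n = 0 ∨ (weightOf E T - n) % n ≠ 0 := by
  classical
  obtain ⟨hTr, hHT⟩ := mem_incSubsetsH_iff.mp hTrH
  obtain ⟨hTs, hcard, x, hx⟩ := mem_incSubsets_iff.mp hTr
  rcases Nat.lt_or_ge n (weightOf E T) with hlt | hge
  swap
  · exact Or.inl (Nat.sub_eq_zero_of_le hge)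
  -- `weightOf E T = weightOf E (T.erase H)`
  set S := T.erase H with hS
  have hWS : weightOf E T = weightOf E S := by
    have h := weightOf_insert E (Finset.notMem_erase H T) (K := H)
    rw [Finset.insert_erase hHT, hH0, zero_add] at h
    exact h
  by_cases hS1 : S.card ≤ 1
  · -- phase `r ≤ 2`: `S = ∅` or `S = {K}`
    obtain ⟨K, hSK⟩ := Finset.card_le_one_iff_subset_singleton.mp hS1
    rcases Finset.subset_singleton_iff.mp hSK with hS0 | hSeq
    · rw [hWS, hS0, weightOf_empty] at hlt
      exact absurd hlt (Nat.not_lt_zero n)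
    · have hKS : K ∈ S := by rw [hSeq]; exact Finset.mem_singleton_self K
      have hKT : K ∈ T := Finset.mem_of_mem_erase hKS
      have hWK : weightOf E T = expOf E K := by rw [hWS, hSeq]; rfl
      rcases hnr K hKT with h0 | hmod
      · rw [hWK, h0] at hlt
        exact absurd hlt (Nat.not_lt_zero n)
      · obtain ⟨d, hd⟩ := Nat.exists_eq_add_of_le (hWK ▸ hlt).le
        have hsub : weightOf E T - n = d := by omega
        rw [hd, Nat.add_mod_left] at hmod
        rw [hsub]
        exact Or.inr hmod
  · -- phase `r ≥ 3`: the star bounds make the new label `< n`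
    push Not at hS1
    obtain ⟨K, hKS⟩ : S.Nonempty := Finset.card_pos.mp (by omega)
    have hKT : K ∈ T := Finset.mem_of_mem_erase hKS
    have hKH : K ≠ H := Finset.ne_of_mem_erase hKS
    have hST : S.card + 1 = T.card := Finset.card_erase_add_one hHT
    have hr3 : 3 ≤ r := by omega
    have h1 : weightOf E (T.erase K) < n :=
      hstar (r - 1) (by omega) _ (mem_incSubsets_iff.mpr ⟨(Finset.erase_subset K T).trans hTs,
        by rw [Finset.card_erase_of_mem hKT, hcard], x, fun K' hK' => hx K' (Finset.mem_of_mem_erase hK')⟩)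
        (Finset.mem_erase.mpr ⟨hKH.symm, hHT⟩)
    have h2 : weightOf E {H, K} < n := by
      refine hstar 2 (by omega) _ (mem_incSubsets_iff.mpr ⟨?_, Finset.card_pair hKH.symm, x, fun K' hK' => ?_⟩)
        (Finset.mem_insert_self H {K})
      · exact Finset.insert_subset_iff.mpr ⟨hTs hHT, Finset.singleton_subset_iff.mpr (hTs hKT)⟩
      · rcases Finset.mem_insert.mp hK' with rfl | hK'
        · exact hx _ hHT
        · rw [Finset.mem_singleton.mp hK']; exact hx _ hKT
    have hWK : weightOf E T = expOf E K + weightOf E (T.erase K) := by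
      have h := weightOf_insert E (Finset.notMem_erase K T) (K := K)
      rw [Finset.insert_erase hKT] at h
      exact h
    have hKle : expOf E K ≤ weightOf E {H, K} := weightOf_mono E (Finset.subset_insert H {K})
    have hKn : expOf E K < n := lt_of_le_of_lt hKle h2
    have hsub : weightOf E T - n < expOf E K := by omega
    by_cases hz : weightOf E T - n = 0
    · exact Or.inl hz
    · refine Or.inr ?_
      rw [Nat.mod_eq_of_lt (lt_trans hsub hKn)]
      exact hz

end Labels

/-! ### §Round — the non-resonant shape survives a STRATEGY round; the list law -/

section Round

variable {X X' : Scheme.{0}} [IsLocallyNoetherian X] {π : X' ⟶ X} {H : X.IdealSheafData}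
  {E : List (X.IdealSheafData × ℕ)} {T : Finset X.IdealSheafData} {n : ℕ} {M : MarkedIdeal X}

/-- ★ **THE NON-RESONANT SHAPE SURVIVES A STRATEGY ROUND** (any marking `n ≠ 0`, any characteristic): the blow-up of the face of an
`r`-set `T ∋ H` of weight `≥ n` in phase `r`.  Shape: the EXACT-face round lemma (N23b; every face of a non-resonant datum is exact —
the higher-order Hasse guard of N23a); exponents of the new boundary: a strict transform keeps `expOf E K`
(`eq_of_strictTransformIdeal_eq`), the exceptional divisor gets `weightOf E T − n` (`weightOf_transformExp`,
`strictTransformIdeal_ne_comap`), which §Labels keeps non-resonant.  (Bookkeeping = R22a's `ncHypShapeLow.transform_star`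
re-instantiated; declared 0-weight.) [new] [cite: Kollar2007, (3.111) Step 3] [cite: EGAIV4, Thm. 16.11.2] -/
theorem ncHypShapeNR.transform_star {r : ℕ} (hEs : HasSNC (H :: boundaryOf E)) (hT : ∀ K ∈ T, K ∈ H :: boundaryOf E)
    (hHT : H ∈ T) (hπ : IsBlowup π (T.sup id)) (hmT : n ≤ weightOf E T) (hTrH : T ∈ incSubsetsH E H r)
    (hstar : StarBelowH E H n r) (hP : ncHypShapeNR n X E H M) :
    ncHypShapeNR n X' (transformExp E π T n) (strictTransformIdeal π (T.sup id) H) (M.transform π (T.sup id)) := by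
  classical
  haveI : IsProper π := hπ.isProper
  haveI : IsLocallyNoetherian X' := LocallyOfFiniteType.isLocallyNoetherian π
  refine ⟨hP.toF.transform_of_exact hEs hT hHT hπ hmT hP.ne_zero (hP.exactFace T), hP.ne_zero, fun G x' hx' => ?_⟩
  -- the exponents of the new boundary members through `x'`
  rw [expOf, weightOf_transformExp]
  by_cases hGF : (T.sup id).comap π ∈ ({G} : Finset X'.IdealSheafData)
  · -- the exceptional divisor: exponent `weightOf E T − n`
    have hGF' : (T.sup id).comap π = G := Finset.mem_singleton.mp hGF
    rw [if_pos hGF]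
    have hxF : x' ∈ ((T.sup id).comap π).support := by rw [hGF']; exact hx'
    have hxC : π x' ∈ (T.sup id).support := by
      have h : x' ∈ ((((T.sup id).comap π).support : Set X')) := hxF
      rwa [Scheme.IdealSheafData.support_comap] at h
    have hyT : ∀ K ∈ T, π x' ∈ K.support := (mem_support_finsetSup_iff T (π x')).mp hxC
    have hpre : pre E π T {G} = ∅ := by
      refine Finset.eq_empty_of_forall_notMem fun K hK => ?_
      obtain ⟨hKs, hKG⟩ := mem_pre_iff.mp hK
      rw [Finset.mem_singleton, ← hGF'] at hKG
      exact strictTransformIdeal_ne_comap hEs hT hπ (List.mem_cons_of_mem _ (mem_sheaves_iff.mp hKs)) hxF hKG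
    rw [hpre, weightOf_empty, zero_add]
    have hH0 : expOf E H = 0 := expOf_eq_zero_of_labels fun q hq hqH =>
      (hP.toF.label_eq_zero hq hqH).resolve_right (Set.nonempty_iff_ne_empty.mp ⟨π x', hyT H hHT⟩)
    exact nr_weightOf_sub_of_starBelowH hTrH hstar hH0 fun K hK => hP.labels (hyT K hK)
  · -- a strict transform: exponent `expOf E K` of the unique old member behind it
    rw [if_neg hGF, add_zero]
    by_cases hex : ∃ K, K ∈ pre E π T {G}
    · obtain ⟨K, hK⟩ := hex
      obtain ⟨hKs, hKG⟩ := mem_pre_iff.mp hK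
      rw [Finset.mem_singleton] at hKG
      have hxK' : x' ∈ (strictTransformIdeal π (T.sup id) K).support := by rw [hKG]; exact hx'
      have hxK : π x' ∈ K.support := mem_support_of_mem_support_strictTransformIdeal hxK'
      have hpre : pre E π T {G} = {K} := by
        refine Finset.eq_singleton_iff_unique_mem.mpr ⟨hK, fun K' hK' => ?_⟩
        obtain ⟨hK's, hK'G⟩ := mem_pre_iff.mp hK'
        rw [Finset.mem_singleton] at hK'G
        exact (eq_of_strictTransformIdeal_eq hEs hT hπ (List.mem_cons_of_mem _ (mem_sheaves_iff.mp hKs))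
          (List.mem_cons_of_mem _ (mem_sheaves_iff.mp hK's)) hxK' (hKG.trans hK'G.symm)).symm
      rw [hpre]
      exact hP.labels hxK
    · push Not at hex
      rw [Finset.eq_empty_of_forall_notMem fun K hK => hex K hK, weightOf_empty]
      exact Or.inl rfl

/-- ★ **THE NON-RESONANT SHAPE IS FACE-STABLE ALONG THE STRATEGY** (T16 `FaceStableShapeStar`, marking `n`). [new] -/
theorem faceStableShapeStar_ncHypShapeNR (n : ℕ) : FaceStableShapeStar n (ncHypShapeNR n) where
  round _ _ _ _ T _ _ hEs _ hT hHT hmT hTrH hstar hP :=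
    hP.transform_star hEs hT hHT (blowup.isBlowup (T.sup id)) hmT hTrH hstar
  face _ _ _ _ _ _ hEs hHT hmT hP := support_finsetSup_subset_support_ncHypShapeF hEs hHT hmT hP.toF
  terminal _ _ _ _ _ hEs _ hP h := support_ncHypShapeF_eq_empty (hasSNC_boundaryOf_of_cons hEs) hP.toF h

/-- ★★ **THE LIST LAW OF THE NON-RESONANT CLASS**: on a locally Noetherian scheme (ANY characteristic), a non-resonant datum for a
labelled boundary `E ∋ H` with `H :: E` s.n.c. admits a weak resolution — Kollár's strategy through `H` (T16) BY NAME, every round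
certified by the higher-order Hasse guard. [new] [cite: Kollar2007, (3.111) Step 3] [cite: EGAIV4, Thm. 16.11.2] -/
theorem ncHypShapeNR.exists_weakResolution (hEs : HasSNC (H :: boundaryOf E)) (hH : H ∈ boundaryOf E)
    (hP : ncHypShapeNR n X E H M) : ∃ s : CentreSeq X, WeakResolution s M :=
  (faceStableShapeStar_ncHypShapeNR n).exists_weakResolution hEs hH M hP

-- R22a's low-residue list law re-derived through the non-resonant class (consistency check; a different round engine).
example {p : ℕ} (hEs : HasSNC (H :: boundaryOf E)) (hH : H ∈ boundaryOf E) (hP : ncHypShapeLow p n X E H M) :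
    ∃ s : CentreSeq X, WeakResolution s M :=
  hP.toNR.exists_weakResolution hEs hH

end Round

end Summit.ResolutionOfSingularities.ResolutionOfSingularities.Theorems.DeltaCutClasses
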